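import Summits.ResolutionOfSingularities.ResolutionOfSingularities.Theorems.PurelyInseparableDim4ChartAtlasCover
import HarnessLib

/-!
# Purely inseparable four-folds: OWNERSHIP PARTITION of an atlas member — every point belongs to the first chart that sees it
# (brick S3 (c) v4 «atlas members», tranche 1, brick A1a; cell `res-dim4-pi`)

[OURS · counted 0] (D-0157 DOOR 2; host item stmt-ResolutionOfSingularities-16155, helper). Nothing here proves resolution of
singularities in dimension ≥ 4 / characteristic `p`. For ANY blowing up `π : W → 𝔸⁵` along a coordinate subspace `V(x_Λ)`:

* §1 `chartImm_apply_mem_opensRange_iff` — a point `y` of the `x_i`-chart lies in the `x_m`-chart (`m ≠ i` in `Λ`) IFF `x_m ∉ 𝔭_y`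
  (typ-2's `ChartDictionary.chartImm_apply_mem_opensRange_of_not_mem` p68x with its converse: `W[x_i] ∩ W[x_m] = D(x_m/x_i)` pulls back to
  `D(x_m)` on the `x_i`-chart).
* §2 **`owned_pieces_cover`**, **`owned_pieces_disjoint`** — a set `Z ⊆ W` covered by re-centred charts `φ_m = Spec Θ_m ≫ chartImm_m`
  (`m ∈ P`, the re-centrings fixing the chart variables `x_{m′}`, `m′ ∈ P`) and reading `C_m ⊆ 𝔸⁵` on chart `m` (`Z ∩ range φ_m = φ_m(C_m)`)
  is the DISJOINT union over `m ∈ P` of the OWNED pieces `φ_m(C_m ∩ V(x_{m′} : rk m′ < rk m))` for any ranking `rk` injective on `P`: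
  the format clause «member covered by the readings' owned parts, pairwise disjoint» of `MemberAtlasZ` (v4 defs, `…AtlasMemberDefs`),
  discharged for the readings of a linear escaping child (`res-dim4-typ-3/S3c-V4-ATLAS-MEMBERS-DESIGN.md` §7 (c)).

AI-produced formalisation, weaker than expert review. bears_on: LADDER-RESOLUTION:D157-DOOR2 (res-dim4-pi · S3 (c) v4 ownership).
-/

set_option linter.dupNamespace false -- D-0017: single-problem summit path `Summit.<S>.<S>.…` by design

noncomputable section

open MvPolynomial Finset CategoryTheory AlgebraicGeometry Opposite TopologicalSpace

namespace Summit.ResolutionOfSingularities.ResolutionOfSingularities.Theorems.PIDim4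

open Literature.AlgebraicGeometry.Resolution
open Literature.AlgebraicGeometry.Resolution.AffinePointBlowup (P A γ coord Wtop ξ)

namespace Equimultiple

/-! ## §1 Chart overlap, both directions -/

section Overlap

variable {K : Type} [Field K] {Λ : Set (Fin (4 + 1))} {W : Scheme.{0}} {π : W ⟶ P 4 K}

/-- **A point of the `x_i`-chart lies in the `x_m`-chart iff `x_m` does not vanish at it** (`m ≠ i` in `Λ`), for any blowing up of
`𝔸⁵` along `V(x_Λ)`: `W[x_i] ∩ W[x_m] = D(T)` for the chart ratio `T = π^*x_m / π^*x_i`, whose pull-back to the `x_i`-chart is `x_m`.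
[cite: Hauser2010, §G (chart expressions and their overlaps)] [cite: StacksProject, Tag 0804] -/
theorem chartImm_apply_mem_opensRange_iff (hπ : IsBlowup π (AffineCoordBlowup.𝓘Λ 4 K Λ))
    {i m : Fin (4 + 1)} (hi : i ∈ Λ) (hm : m ∈ Λ) (hmi : m ≠ i) (y : P 4 K) :
    AffineCoordBlowup.chartImm hπ hi y ∈ (AffineCoordBlowup.chartImm hπ hm).opensRange ↔ (X m : A 4 K) ∉ y.asIdeal := by
  refine ⟨fun hw => ?_, ChartDictionary.chartImm_apply_mem_opensRange_of_not_mem hπ hi hm hmi⟩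
  have hiI := AffineCoordBlowup.coord_mem_𝓘Λ 4 K _ hi
  have hmI := AffineCoordBlowup.coord_mem_𝓘Λ 4 K _ hm
  obtain ⟨T, hT⟩ := hπ.exists_chartRatio (Wtop 4 K) hiI hmI
  have hbo := hπ.basicOpen_chartRatio (Wtop 4 K) hiI hmI hT
  rw [AffineCoordBlowup.opensRange_chartImm hπ hm] at hw
  change _ ∈ blowupChart π (AffineCoordBlowup.𝓘Λ 4 K Λ) (Wtop 4 K) (coord 4 K m) at hw
  set cᵢ := AffineCoordBlowup.chartImm hπ hi with hcᵢ
  have hyV : y ∈ cᵢ ⁻¹ᵁ blowupChart π (AffineCoordBlowup.𝓘Λ 4 K Λ) (Wtop 4 K) (coord 4 K i) := by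
    change cᵢ y ∈ AffineCoordBlowup.chart Λ π i
    rw [← AffineCoordBlowup.opensRange_chartImm hπ hi]
    exact ⟨y, rfl⟩
  have hmem : cᵢ y ∈ W.basicOpen T := by rw [hbo]; exact ⟨hyV, hw⟩
  have hmem' : y ∈ cᵢ ⁻¹ᵁ W.basicOpen T := hmem
  rw [Scheme.preimage_basicOpen] at hmem'
  -- `𝔸⁵` is integral: sections over the nonempty `V` form a domain, restriction from `⊤` is injective
  haveI : Nonempty (P 4 K) := ⟨ξ 4 K⟩
  haveI : IsDomain Γ(P 4 K, ⊤) := AffinePointBlowup.isDomain_Γ 4 K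
  haveI : IsIntegral (P 4 K) := isIntegral_of_isAffine_of_isDomain (P 4 K)
  haveI : IsDomain Γ(P 4 K, cᵢ ⁻¹ᵁ blowupChart π (AffineCoordBlowup.𝓘Λ 4 K Λ) (Wtop 4 K) (coord 4 K i)) :=
    @IsIntegral.component_integral (P 4 K) _ _ ⟨⟨y, hyV⟩⟩
  set ρ := (P 4 K).presheaf.map (homOfLE (le_top :
    cᵢ ⁻¹ᵁ blowupChart π (AffineCoordBlowup.𝓘Λ 4 K Λ) (Wtop 4 K) (coord 4 K i) ≤ ⊤)).op with hρ
  have hρinj : Function.Injective ρ :=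
    map_injective_of_isIntegral (X := P 4 K) (homOfLE _) (H := ⟨⟨y, hyV⟩⟩)
  have key : ∀ s : Γ(P 4 K, ⊤),
      cᵢ.app _ (π.appLE ⊤ _ (blowupChart_le_preimage π (AffineCoordBlowup.𝓘Λ 4 K Λ) (Wtop 4 K) (coord 4 K i)) s) =
        ρ ((Spec.map (CommRingCat.ofHom (coordBlowupSubst K Λ i).toRingHom)).appTop s) := by
    intro s
    rw [Scheme.Hom.app_eq_appLE, ← CommRingCat.comp_apply, Scheme.Hom.appLE_comp_appLE,
      appLE_congr_hom (AffineCoordBlowup.chartImm_comp hπ hi)]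
    rfl
  have hTm := congrArg (cᵢ.app _) hT
  rw [map_mul, key, key] at hTm
  change ρ ((Spec.map _).appTop.hom ((γ 4 K).symm (X m))) = ρ ((Spec.map _).appTop.hom ((γ 4 K).symm (X i))) * _ at hTm
  rw [ChartDictionary.appTop_specMap_γ_symm, ChartDictionary.appTop_specMap_γ_symm] at hTm
  change ρ ((γ 4 K).symm (coordBlowupSubst K _ i (X m))) = ρ ((γ 4 K).symm (coordBlowupSubst K _ i (X i))) * _ at hTm
  rw [coordBlowupSubst_X_self, coordBlowupSubst_X_of_mem_of_ne K _ i hm hmi, map_mul, map_mul] at hTm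
  have hxi : ρ ((γ 4 K).symm (X i)) ≠ 0 := fun h =>
    AffinePointBlowup.coord_ne_zero 4 K i (hρinj ((h.trans (map_zero _).symm : ρ (coord 4 K i) = ρ 0)))
  have ht : cᵢ.app _ T = ρ ((γ 4 K).symm (X m)) := (mul_left_cancel₀ hxi hTm).symm
  rw [ht, hρ, Scheme.basicOpen_res] at hmem'
  have h2 : y ∈ (P 4 K).basicOpen ((γ 4 K).symm (X m)) := hmem'.2
  rw [AffinePointBlowup.γ_symm_apply, basicOpen_eq_of_affine] at h2
  exact h2

/-- The same for a RE-CENTRED chart `Spec Θ ≫ chartImm_i` whose re-centring fixes `x_m`: the point `y` lies in the `x_m`-chart iff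
`x_m ∉ 𝔭_y`. [folklore] -/
theorem specMap_chartImm_apply_mem_opensRange_iff (hπ : IsBlowup π (AffineCoordBlowup.𝓘Λ 4 K Λ))
    {i m : Fin (4 + 1)} (hi : i ∈ Λ) (hm : m ∈ Λ) (hmi : m ≠ i) (Θ : A 4 K ≃ₐ[K] A 4 K) (hΘ : Θ (X m) = X m) (y : P 4 K) :
    (Spec.map (CommRingCat.ofHom (Θ : A 4 K →+* A 4 K)) ≫ AffineCoordBlowup.chartImm hπ hi) y ∈
        (AffineCoordBlowup.chartImm hπ hm).opensRange ↔ (X m : A 4 K) ∉ y.asIdeal := by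
  rw [Scheme.Hom.comp_apply, chartImm_apply_mem_opensRange_iff hπ hi hm hmi]
  rw [Spec.map_apply, PrimeSpectrum.comap_asIdeal, Ideal.mem_comap, CommRingCat.hom_ofHom]
  change Θ (X m) ∉ y.asIdeal ↔ _
  rw [hΘ]

end Overlap

/-! ## §2 The ownership partition -/

section Ownership

variable {K : Type} [Field K] {Λ : Set (Fin (4 + 1))} {W : Scheme.{0}} {π : W ⟶ P 4 K}

/-- **OWNED PIECES COVER.** Charts `φ_m = Spec Θ_m ≫ chartImm_m` (`m ∈ P`; every `Θ_m` fixes the chart variables `x_{m′}`, `m′ ∈ P`),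
a set `Z ⊆ ⋃_m range φ_m` reading `C_m` on chart `m` (`Z ∩ range φ_m = φ_m(C_m)`), any ranking `rk`: then
`Z ⊆ ⋃_m φ_m(C_m ∩ V(x_{m′} : m′ ∈ P, rk m′ < rk m))` — every point is owned by the FIRST chart that sees it.
[cite: BierstoneGrigorievMilmanWlodarczyk2011, Def. 3.1.3 (4)] [cite: Hauser2010, §G] -/
theorem owned_pieces_cover (hπ : IsBlowup π (AffineCoordBlowup.𝓘Λ 4 K Λ)) (Pc : Finset (Fin (4 + 1))) (hP : ∀ m ∈ Pc, m ∈ Λ)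
    (Θ : Fin (4 + 1) → (A 4 K ≃ₐ[K] A 4 K)) (hΘ : ∀ m ∈ Pc, ∀ m' ∈ Pc, Θ m (X m') = X m')
    (C : Fin (4 + 1) → Set (P 4 K)) (rk : Fin (4 + 1) → ℕ) (Z : Set W)
    (hZ : ∀ m (hm : m ∈ Pc), Z ∩ Set.range (Spec.map (CommRingCat.ofHom (Θ m : A 4 K →+* A 4 K)) ≫
        AffineCoordBlowup.chartImm hπ (hP m hm)) =
      (Spec.map (CommRingCat.ofHom (Θ m : A 4 K →+* A 4 K)) ≫ AffineCoordBlowup.chartImm hπ (hP m hm)) '' C m)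
    (hcov : Z ⊆ ⋃ (m : Fin (4 + 1)) (hm : m ∈ Pc),
      Set.range (Spec.map (CommRingCat.ofHom (Θ m : A 4 K →+* A 4 K)) ≫ AffineCoordBlowup.chartImm hπ (hP m hm))) :
    Z ⊆ ⋃ (m : Fin (4 + 1)) (hm : m ∈ Pc),
      (Spec.map (CommRingCat.ofHom (Θ m : A 4 K →+* A 4 K)) ≫ AffineCoordBlowup.chartImm hπ (hP m hm)) ''
        (C m ∩ {y : P 4 K | ∀ m' ∈ Pc, rk m' < rk m → (X m' : A 4 K) ∈ y.asIdeal}) := by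
  intro w hw
  -- the charts that see `w`, and the first of them
  classical
  set Q : Finset (Fin (4 + 1)) := Pc.filter fun m => ∃ hm : m ∈ Pc,
    w ∈ Set.range (Spec.map (CommRingCat.ofHom (Θ m : A 4 K →+* A 4 K)) ≫ AffineCoordBlowup.chartImm hπ (hP m hm)) with hQ
  have hQne : Q.Nonempty := by
    obtain ⟨m, hm, hwm⟩ : ∃ m, ∃ hm : m ∈ Pc,
        w ∈ Set.range (Spec.map (CommRingCat.ofHom (Θ m : A 4 K →+* A 4 K)) ≫ AffineCoordBlowup.chartImm hπ (hP m hm)) := by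
      simpa only [Set.mem_iUnion] using hcov hw
    exact ⟨m, Finset.mem_filter.mpr ⟨hm, hm, hwm⟩⟩
  obtain ⟨m, hmQ, hmin⟩ := Q.exists_min_image rk hQne
  obtain ⟨hmP, hmP', hwm⟩ := Finset.mem_filter.mp hmQ
  -- `w = φ_m y` with `y ∈ C_m`
  have hwZ : w ∈ Z ∩ Set.range (Spec.map (CommRingCat.ofHom (Θ m : A 4 K →+* A 4 K)) ≫
      AffineCoordBlowup.chartImm hπ (hP m hmP')) := ⟨hw, hwm⟩
  rw [hZ m hmP'] at hwZ
  obtain ⟨y, hyC, rfl⟩ := hwZ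
  refine Set.mem_iUnion₂.mpr ⟨m, hmP', y, ⟨hyC, fun m' hm' hlt => ?_⟩, rfl⟩
  -- an earlier chart `m′` does not see `w`, so `x_{m′} ∈ 𝔭_y`
  by_contra hnot
  have hne : m' ≠ m := fun h => by subst h; exact lt_irrefl _ hlt
  have hsee : (Spec.map (CommRingCat.ofHom (Θ m : A 4 K →+* A 4 K)) ≫ AffineCoordBlowup.chartImm hπ (hP m hmP')) y ∈
      (AffineCoordBlowup.chartImm hπ (hP m' hm')).opensRange :=
    (specMap_chartImm_apply_mem_opensRange_iff hπ (hP m hmP') (hP m' hm') hne (Θ m) (hΘ m hmP' m' hm') y).mpr hnot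
  have hsee' : (Spec.map (CommRingCat.ofHom (Θ m : A 4 K →+* A 4 K)) ≫ AffineCoordBlowup.chartImm hπ (hP m hmP')) y ∈
      Set.range (Spec.map (CommRingCat.ofHom (Θ m' : A 4 K →+* A 4 K)) ≫ AffineCoordBlowup.chartImm hπ (hP m' hm')) := by
    rw [ChartDictionary.range_specMap_comp_chartImm hπ (hP m' hm') (Θ m')]
    exact hsee
  have hm'Q : m' ∈ Q := Finset.mem_filter.mpr ⟨hm', hm', hsee'⟩
  exact absurd (hmin m' hm'Q) (not_le.mpr hlt)

/-- **OWNED PIECES ARE DISJOINT.** With the same data, the owned pieces of two different charts do not meet: a point owned by `m` has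
`x_{m′} ∈ 𝔭` for every earlier `m′`, hence is invisible to the chart `m′`. [cite: BierstoneGrigorievMilmanWlodarczyk2011, Def. 3.1.3 (4)] -/
theorem owned_pieces_disjoint (hπ : IsBlowup π (AffineCoordBlowup.𝓘Λ 4 K Λ)) (Pc : Finset (Fin (4 + 1))) (hP : ∀ m ∈ Pc, m ∈ Λ)
    (Θ : Fin (4 + 1) → (A 4 K ≃ₐ[K] A 4 K)) (hΘ : ∀ m ∈ Pc, ∀ m' ∈ Pc, Θ m (X m') = X m')
    (C : Fin (4 + 1) → Set (P 4 K)) (rk : Fin (4 + 1) → ℕ) (hrk : Set.InjOn rk Pc)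
    {m m' : Fin (4 + 1)} (hm : m ∈ Pc) (hm' : m' ∈ Pc) (hne : m ≠ m') :
    Disjoint
      ((Spec.map (CommRingCat.ofHom (Θ m : A 4 K →+* A 4 K)) ≫ AffineCoordBlowup.chartImm hπ (hP m hm)) ''
        (C m ∩ {y : P 4 K | ∀ m'' ∈ Pc, rk m'' < rk m → (X m'' : A 4 K) ∈ y.asIdeal}))
      ((Spec.map (CommRingCat.ofHom (Θ m' : A 4 K →+* A 4 K)) ≫ AffineCoordBlowup.chartImm hπ (hP m' hm')) ''
        (C m' ∩ {y : P 4 K | ∀ m'' ∈ Pc, rk m'' < rk m' → (X m'' : A 4 K) ∈ y.asIdeal})) := by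
  have hrne : rk m ≠ rk m' := fun h => hne (hrk hm hm' h)
  -- without loss of generality `rk m′ < rk m`
  wlog hlt : rk m' < rk m generalizing m m'
  · exact (this hm' hm hne.symm hrne.symm (lt_of_le_of_ne (not_lt.mp hlt) hrne)).symm
  refine Set.disjoint_left.mpr ?_
  rintro w ⟨y, ⟨-, hy⟩, rfl⟩ ⟨y', ⟨-, -⟩, hyy'⟩
  -- `w` is owned by `m`, so `x_{m′} ∈ 𝔭_y` and `w` is not in the chart `m′`; but it is `φ_{m′} y′`
  have hnot : (Spec.map (CommRingCat.ofHom (Θ m : A 4 K →+* A 4 K)) ≫ AffineCoordBlowup.chartImm hπ (hP m hm)) y ∉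
      (AffineCoordBlowup.chartImm hπ (hP m' hm')).opensRange := fun h =>
    (specMap_chartImm_apply_mem_opensRange_iff hπ (hP m hm) (hP m' hm') hne.symm (Θ m) (hΘ m hm m' hm') y).mp h
      (hy m' hm' hlt)
  refine hnot ?_
  have : (Spec.map (CommRingCat.ofHom (Θ m : A 4 K →+* A 4 K)) ≫ AffineCoordBlowup.chartImm hπ (hP m hm)) y ∈
      Set.range (Spec.map (CommRingCat.ofHom (Θ m' : A 4 K →+* A 4 K)) ≫ AffineCoordBlowup.chartImm hπ (hP m' hm')) :=
    ⟨y', hyy'⟩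
  rwa [ChartDictionary.range_specMap_comp_chartImm hπ (hP m' hm') (Θ m')] at this

end Ownership

end Equimultiple

end Summit.ResolutionOfSingularities.ResolutionOfSingularities.Theorems.PIDim4

end
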